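import Literature.Barriers.AnomalousDissipation.ObukhovCorrsinThresholdBesov
import HarnessLib

/-!
# The Obukhov–Corrsin threshold along families with growing velocity norms

Barrier-audit addendum (2026-08-17, gen 4, D-0021) to the named fact
`Literature.Barriers.AnomalousDissipation.DrivasElgindiIyerJeong2022_thm4`
(`Barriers/AnomalousDissipation/ObukhovCorrsinThreshold`, scope caveat (ix)).

The printed bound (5.10) of Drivas–Elgindi–Iyer–Jeong 2022 (proof of Thm. 4) at a free
mollification scale `ℓ`,
`2κ∫₀ᵀ‖∇θ‖² ≤ M²ℓ^{2β} + 4dC₁M²‖u‖_{L¹_tC^α_x} ℓ^{α+2β-1} + 2dC₁²TM² κℓ^{2β-2}`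
(vendored as `DrivasElgindiIyerJeong2022_thm4.two_mul_eScalarDissipation_le`, and with
`‖u‖_{L¹_t B^α_{1,∞}}` in place of `‖u‖_{L¹_t C^α}` as `two_mul_eScalarDissipation_le_besov`), is
AFFINE in the velocity norm. The print optimises `ℓ = κ^{1/(α+1)}` at a fixed norm bound `K`;
re-optimising `ℓ = ¼κ^s` along a family `κ_j → 0` whose velocity norms are allowed to GROW,
`‖u_j‖ ≤ A κ_j^{-γ}` (`γ ≥ 0`), the three terms are `κ_j^{2βs}`, `κ_j^{s(α+2β-1)-γ}`,
`κ_j^{1-s(2-2β)}`, and an admissible `s` exists exactly when `γ(2-2β) < α+2β-1`, i.e. above the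
shifted threshold
`β > (1 - α + 2γ)/(2 + 2γ)`
(the Obukhov–Corrsin line `β > (1-α)/2` at `γ = 0`; `β > γ/(1+γ)` at `α = 1`). Scalars bounded in
`L^∞_t C^β` uniformly along such a family, with `β` above the shifted threshold, carry no
anomalous dissipation. This replaces the cruder sufficient condition
`K_j = o(κ_j^{-(α+2β-1)/(α+1)})` (fixed optimisation) recorded in scope caveat (ii).

Use (scope caveat (ix) of the barrier, on paper beyond the window form proved here): in the
regime of crux `ScalarAnomalySteadySourceFormal` of route TwoAndHalfD (planar Leray–Hopf
velocities `v_j` driven by ONE steady smooth force `g` with bounded mean energy `⟨‖v_j‖²⟩ ≤ E`,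
`Pr = 1`) the Alexakis–Doering balance `ε² ≤ νU²χ`, `χ ≤ U‖Δg‖₂` gives
`⟨‖∇v_j‖₂²⟩ ≤ (E³‖Δg‖₂²)^{1/4} ν_j^{-1/2}` with no further hypothesis, so that
`‖v_j‖_{L¹(0,T; B¹_{1,∞})} ≤ ∫₀ᵀ‖∇v_j‖₂ ≲ T ν_j^{-1/4}` in long-time mean: `α = 1`, `γ = 1/4`, and
the velocity hypothesis of the barrier is supplied by the crux itself — witness scalars must be
unbounded in `C^β` (time-uniformly, or in time-`L⁴` mean) for every `β > 1/5`.

## Contents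

* `GrowingNorms.threeTerm_tendsto_zero`, `GrowingNorms.tendsto_zero_of_scale_bound` — the
  re-optimisation (pure real analysis / `ℝ≥0∞` squeeze);
* `GrowingNorms.exists_scale_exponent` — an admissible `s` exists iff-direction
  `γ(2-2β) < α+2β-1 ⇒ ∃ s`;
* `DrivasElgindiIyerJeong2022_thm4.noAnomaly_of_growing_holderNorms` — Hölder velocities
  `‖u_j‖_{L¹_tC^{0,α}} ≤ Aκ_j^{-γ}`;
* `DrivasElgindiIyerJeong2022_thm4_besov.noAnomaly_of_growing_besovNorms` — `L¹_t B^α_{1,∞}`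
  velocities bounded at a.e. time, `‖u_j‖_{L¹_tB^α_{1,∞}} ≤ Aκ_j^{-γ}`.

## References

* T. D. Drivas, T. M. Elgindi, G. Iyer, I.-J. Jeong, Arch. Ration. Mech. Anal. 243 (2022)
  1151–1180, Thm. 4 and its proof, §5, (5.9)–(5.10) (arXiv:1911.03271, pp. 17–18). Bib key
  `DrivasEtAl2022`.
* A. Alexakis, C. R. Doering, Phys. Lett. A 359 (2006) 652–657, §2 (`ε² ≤ νU²χ`,
  `χ ≤ U⟨‖Δf‖²⟩^{1/2}`), §4 (single-shell forcing). Bib key `AlexakisDoering2006PLA`.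
-/

open MeasureTheory Set Filter Topology Function
open scoped ENNReal NNReal

noncomputable section

namespace Literature.Barriers.AnomalousDissipation

open Literature.Analysis Literature.Analysis.FunctionSpaces Literature.Analysis.FluidPDE

namespace GrowingNorms

/-- **The three terms of (5.10) at the scale `ℓ_j = ¼κ_j^s` tend to zero** when the velocity
norms grow at most like `K_j ≤ Aκ_j^{-γ}` and `γ < s(α+2β-1)`, `s(2-2β) < 1`:
`a ℓ_j^{2β} + 2(b ℓ_j^{α+2β-1} K_j + T κ_j c ℓ_j^{2β-2}) → 0`. [folklore] -/
theorem threeTerm_tendsto_zero {κ K : ℕ → ℝ} {A γ s α β a b c T : ℝ}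
    (hκ : ∀ j, 0 < κ j) (hκ₀ : Tendsto κ atTop (𝓝 0)) (hK0 : ∀ j, 0 ≤ K j)
    (hK : ∀ᶠ j in atTop, K j ≤ A * κ j ^ (-γ)) (hb : 0 ≤ b) (hβ : 0 < β) (hs : 0 < s)
    (hP : γ < s * (α + 2 * β - 1)) (hQ : s * (2 - 2 * β) < 1) :
    Tendsto (fun j => a * (4⁻¹ * κ j ^ s) ^ (2 * β) +
      2 * ((b * (4⁻¹ * κ j ^ s) ^ (α + 2 * β - 1)) * K j +
        T * (κ j * (c * (4⁻¹ * κ j ^ s) ^ (2 * β - 2))))) atTop (𝓝 0) := by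
  have hpow : ∀ j (p : ℝ), (4⁻¹ * κ j ^ s) ^ p = (4⁻¹ : ℝ) ^ p * κ j ^ (s * p) := fun j p => by
    rw [Real.mul_rpow (by norm_num) (Real.rpow_nonneg (hκ j).le _), Real.rpow_mul (hκ j).le]
  -- term 1
  have h1 : Tendsto (fun j => a * (4⁻¹ * κ j ^ s) ^ (2 * β)) atTop (𝓝 0) := by
    have h := ((hκ₀.rpow_const_nhds_zero (p := s * (2 * β)) (by positivity)).const_mul
      ((4⁻¹ : ℝ) ^ (2 * β))).const_mul a
    simp only [mul_zero] at h
    refine h.congr' (Eventually.of_forall fun j => ?_)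
    simp only [hpow]
  -- term 2
  have h2 : Tendsto (fun j => (b * (4⁻¹ * κ j ^ s) ^ (α + 2 * β - 1)) * K j) atTop (𝓝 0) := by
    have hexp : 0 < s * (α + 2 * β - 1) + -γ := by linarith
    have hup : Tendsto (fun j => b * (4⁻¹ : ℝ) ^ (α + 2 * β - 1) * A *
        κ j ^ (s * (α + 2 * β - 1) + -γ)) atTop (𝓝 0) := by
      have h := (hκ₀.rpow_const_nhds_zero hexp).const_mul (b * (4⁻¹ : ℝ) ^ (α + 2 * β - 1) * A)
      simpa using h
    refine squeeze_zero' (Eventually.of_forall fun j => ?_) (hK.mono fun j hj => ?_) hup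
    · exact mul_nonneg (mul_nonneg hb (Real.rpow_nonneg (by
        have := (hκ j).le; positivity) _)) (hK0 j)
    · have hε0 : 0 ≤ b * (4⁻¹ * κ j ^ s) ^ (α + 2 * β - 1) :=
        mul_nonneg hb (Real.rpow_nonneg (by have := (hκ j).le; positivity) _)
      calc b * (4⁻¹ * κ j ^ s) ^ (α + 2 * β - 1) * K j
          ≤ b * (4⁻¹ * κ j ^ s) ^ (α + 2 * β - 1) * (A * κ j ^ (-γ)) := by gcongr
        _ = b * (4⁻¹ : ℝ) ^ (α + 2 * β - 1) * A * κ j ^ (s * (α + 2 * β - 1) + -γ) := by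
            rw [hpow, Real.rpow_add (hκ j)]
            ring
  -- term 3
  have h3 : Tendsto (fun j => T * (κ j * (c * (4⁻¹ * κ j ^ s) ^ (2 * β - 2)))) atTop (𝓝 0) := by
    have hexp : 0 < 1 + s * (2 * β - 2) := by nlinarith
    have h := (hκ₀.rpow_const_nhds_zero hexp).const_mul (T * c * (4⁻¹ : ℝ) ^ (2 * β - 2))
    simp only [mul_zero] at h
    refine h.congr' (Eventually.of_forall fun j => ?_)
    show _ = T * (κ j * (c * (4⁻¹ * κ j ^ s) ^ (2 * β - 2)))
    rw [hpow, Real.rpow_add (hκ j), Real.rpow_one]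
    ring
  have h := h1.add ((h2.add h3).const_mul 2)
  simpa using h

/-- **From the fixed-scale bound to vanishing dissipation** (`ℝ≥0∞` squeeze): if for every `j`
and every scale `ε ∈ (0, ¼]`
`2D_j ≤ a ε^{2β} + 2(b ε^{α+2β-1} K_j + T κ_j c ε^{2β-2})`, `K_j ≤ Aκ_j^{-γ}` eventually,
`κ_j → 0`, and `γ < s(α+2β-1)`, `s(2-2β) < 1` for some `s > 0`, then `D_j → 0`. [folklore] -/
theorem tendsto_zero_of_scale_bound {D : ℕ → ℝ≥0∞} {κ K : ℕ → ℝ} {A γ s α β a b c T : ℝ}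
    (hκ : ∀ j, 0 < κ j) (hκ₀ : Tendsto κ atTop (𝓝 0)) (hK0 : ∀ j, 0 ≤ K j)
    (hK : ∀ᶠ j in atTop, K j ≤ A * κ j ^ (-γ)) (hb : 0 ≤ b) (hβ : 0 < β) (hs : 0 < s)
    (hP : γ < s * (α + 2 * β - 1)) (hQ : s * (2 - 2 * β) < 1)
    (hD : ∀ j, ∀ ε : ℝ, 0 < ε → ε ≤ 1 / 4 → 2 * D j ≤ ENNReal.ofReal (a * ε ^ (2 * β) +
      2 * ((b * ε ^ (α + 2 * β - 1)) * K j + T * (κ j * (c * ε ^ (2 * β - 2)))))) :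
    Tendsto D atTop (𝓝 0) := by
  have hup := ENNReal.tendsto_ofReal (threeTerm_tendsto_zero (a := a) (c := c) (T := T)
    hκ hκ₀ hK0 hK hb hβ hs hP hQ)
  rw [ENNReal.ofReal_zero] at hup
  -- eventually `κ_j ≤ 1`, where the scale `¼κ_j^s` is admissible
  have hev : ∀ᶠ j in atTop, κ j ≤ 1 := (hκ₀.eventually (Iic_mem_nhds one_pos)).mono fun j hj => hj
  refine tendsto_of_tendsto_of_tendsto_of_le_of_le' tendsto_const_nhds hup
    (Eventually.of_forall fun _ => bot_le) (hev.mono fun j hj => ?_)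
  have hε : 0 < 4⁻¹ * κ j ^ s := by have := hκ j; positivity
  have hε' : 4⁻¹ * κ j ^ s ≤ 1 / 4 := by
    have : κ j ^ s ≤ 1 := Real.rpow_le_one (hκ j).le hj hs.le
    linarith
  calc D j ≤ 2 * D j := by rw [two_mul]; exact le_self_add
    _ ≤ _ := hD j _ hε hε'

/-- **An admissible scale exponent exists above the shifted threshold**: for `0 ≤ γ`, `β ≤ 1`
and `γ(2-2β) < α+2β-1` — equivalently `β > (1-α+2γ)/(2+2γ)` — there is `s > 0` with
`γ < s(α+2β-1)` and `s(2-2β) < 1`. [folklore] -/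
theorem exists_scale_exponent {α β γ : ℝ} (hγ : 0 ≤ γ) (hβ1 : β ≤ 1)
    (h : γ * (2 - 2 * β) < α + 2 * β - 1) :
    ∃ s : ℝ, 0 < s ∧ γ < s * (α + 2 * β - 1) ∧ s * (2 - 2 * β) < 1 := by
  have hQ0 : 0 ≤ 2 - 2 * β := by linarith
  have hP : 0 < α + 2 * β - 1 := lt_of_le_of_lt (mul_nonneg hγ hQ0) h
  rcases hQ0.eq_or_lt with hQ | hQ
  · refine ⟨γ / (α + 2 * β - 1) + 1, by positivity, ?_, by rw [← hQ, mul_zero]; exact one_pos⟩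
    rw [add_mul, div_mul_cancel₀ _ hP.ne', one_mul]
    linarith
  · have hlt : γ / (α + 2 * β - 1) < 1 / (2 - 2 * β) := by
      rw [div_lt_div_iff₀ hP hQ, one_mul]
      exact h
    obtain ⟨s, hs1, hs2⟩ := exists_between hlt
    refine ⟨s, lt_of_le_of_lt (by positivity) hs1, ?_, ?_⟩
    · rwa [div_lt_iff₀ hP] at hs1
    · rwa [lt_div_iff₀ hQ] at hs2

end GrowingNorms

/-! ## No anomalous dissipation along families with growing velocity norms -/

/-- **Obukhov–Corrsin threshold with growing Hölder norms of the velocity** (barrier audit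
2026-08-17, gen 4; re-optimisation of DEIJ 2022, (5.10)). Let `β ∈ (0,1]`, `α ≥ 0`, `γ ≥ 0` with
`γ(2-2β) < α+2β-1`, i.e. `β > (1-α+2γ)/(2+2γ)`. Along `κ_j > 0`, `κ_j → 0`, let `u_j ∈ L¹(0,T; C^{0,α})`
be velocity fields with `‖u_j‖_{L¹_tC^{0,α}} ≤ K_j`, `K_j ≤ A κ_j^{-γ}` eventually, data with
`‖θ₀,ⱼ‖_{C^{0,β}} ≤ M` and weak solutions `θ_j` of `∂ₜθ + u_j·∇θ = κ_jΔθ` on `T^d × [0,T)` obeying the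
energy balance and `ess sup_t ‖θ_j(t)‖_{C^{0,β}} ≤ M`. Then `κ_j∫₀ᵀ‖∇θ_j‖²_{L²} → 0`. At `γ = 0` this
is `DrivasElgindiIyerJeong2022_thm4.noAnomalousScalarDissipation`; the proof is the fixed-scale bound
`two_mul_eScalarDissipation_le` at `ℓ_j = ¼κ_j^s`, `γ/(α+2β-1) < s < 1/(2-2β)`.
[cite: DrivasEtAl2022, proof of Thm. 4, (5.10)] -/
theorem DrivasElgindiIyerJeong2022_thm4.noAnomaly_of_growing_holderNorms
    (d : Type*) [Fintype d] [DecidableEq d] {T : ℝ} (hT : 0 < T) {α β : ℝ≥0}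
    (hβ : 0 < β ∧ β ≤ 1) {γ : ℝ} (hγ : 0 ≤ γ) (hOC : γ * (2 - 2 * (β : ℝ)) < (α : ℝ) + 2 * β - 1)
    {M : ℝ≥0} {A : ℝ} (K : ℕ → ℝ≥0) (κ : ℕ → ℝ) (hκ : ∀ j, 0 < κ j)
    (hκ₀ : Tendsto κ atTop (𝓝 0)) (hK : ∀ᶠ j in atTop, (K j : ℝ) ≤ A * κ j ^ (-γ))
    (u : ℕ → ℝ → UnitAddTorus d → EuclideanSpace ℝ d)
    (hu : ∀ j, MemLpHolder 1 α (u j) (Ioo 0 T))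
    (huK : ∀ j, eLpHolderNorm 1 α (u j) (Ioo 0 T) ≤ K j)
    (θ₀ : ℕ → UnitAddTorus d → ℝ) (hθ₀ : ∀ j, eBoundedHolderNorm β (θ₀ j) ≤ M)
    (θ : ℕ → ℝ → UnitAddTorus d → ℝ)
    (hθ : ∀ j, Torus.IsWeakScalarTransportOn T (κ j) (u j) (θ₀ j) (θ j))
    (henergy : ∀ j, ∀ᵐ t ∂((volume : Measure ℝ).restrict (Ioo 0 T)),
      (∫⁻ x, ‖θ j t x‖ₑ ^ 2) + 2 * Torus.eScalarDissipation (κ j) (θ j) 0 t ≤ ∫⁻ x, ‖θ₀ j x‖ₑ ^ 2)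
    (hbound : ∀ j, ∀ᵐ t ∂((volume : Measure ℝ).restrict (Ioo 0 T)),
      eBoundedHolderNorm β (θ j t) ≤ M) :
    Tendsto (fun j => Torus.eScalarDissipation (κ j) (θ j) 0 T) atTop (𝓝 0) := by
  obtain ⟨s, hs, hP, hQ⟩ := GrowingNorms.exists_scale_exponent hγ (by exact_mod_cast hβ.2) hOC
  refine GrowingNorms.tendsto_zero_of_scale_bound (K := fun j => (K j : ℝ))
    (a := (M : ℝ) ^ 2) (b := 2 * Fintype.card d * Torus.gradProfileMass d * (M : ℝ) ^ 2)
    (c := Fintype.card d * (Torus.gradProfileMass d ^ 2 * (M : ℝ) ^ 2)) (T := T)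
    hκ hκ₀ (fun j => NNReal.coe_nonneg _) hK
    (by have := Torus.gradProfileMass_nonneg (d := d); positivity) (by exact_mod_cast hβ.1)
    hs hP hQ fun j ε hε hε' => ?_
  refine (DrivasElgindiIyerJeong2022_thm4.two_mul_eScalarDissipation_le hT hβ.1 (hu j) (huK j)
    (hθ₀ j) (hκ j) (hθ j) (henergy j) (hbound j) hε hε').trans (le_of_eq ?_)
  congr 1
  ring

/-- **Obukhov–Corrsin threshold with growing `L¹_t B^α_{1,∞}` norms of the velocity** (barrier
audit 2026-08-17, gen 4; Besov corner of the preceding theorem, from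
`two_mul_eScalarDissipation_le_besov`). Let `α > 0`, `β ∈ (0,1]`, `γ ≥ 0` with
`γ(2-2β) < α+2β-1`, i.e. `β > (1-α+2γ)/(2+2γ)`. Along `κ_j > 0`, `κ_j → 0`, let `u_j` be velocity
fields bounded at a.e. time with `u_j ∈ L¹(0,T; B^α_{1,∞})`, `‖u_j‖_{L¹_tB^α_{1,∞}} ≤ K_j`,
`K_j ≤ A κ_j^{-γ}` eventually, data with `‖θ₀,ⱼ‖_{C^{0,β}} ≤ M` and weak solutions `θ_j` obeying the
energy balance and `ess sup_t ‖θ_j(t)‖_{C^{0,β}} ≤ M`. Then `κ_j∫₀ᵀ‖∇θ_j‖²_{L²} → 0`. At `α = 1`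
(`[u]_{B¹_{1,∞}} ≤ ‖∇u‖_{L¹}`): families of fields with `∫₀ᵀ‖∇u_j‖_{L¹} ≤ Aκ_j^{-γ}` and scalars
bounded in `L^∞_t C^β`, `β > γ/(1+γ)`, carry no anomaly (`γ = 1/4`: `β > 1/5`).
[cite: DrivasEtAl2022, proof of Thm. 4, (5.10)] -/
theorem DrivasElgindiIyerJeong2022_thm4_besov.noAnomaly_of_growing_besovNorms
    (d : Type*) [Fintype d] [DecidableEq d] {T : ℝ} (hT : 0 < T) {α β : ℝ≥0} (hα : 0 < α)
    (hβ : 0 < β ∧ β ≤ 1) {γ : ℝ} (hγ : 0 ≤ γ) (hOC : γ * (2 - 2 * (β : ℝ)) < (α : ℝ) + 2 * β - 1)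
    {M : ℝ≥0} {A : ℝ} (K : ℕ → ℝ≥0) (κ : ℕ → ℝ) (hκ : ∀ j, 0 < κ j)
    (hκ₀ : Tendsto κ atTop (𝓝 0)) (hK : ∀ᶠ j in atTop, (K j : ℝ) ≤ A * κ j ^ (-γ))
    (u : ℕ → ℝ → UnitAddTorus d → EuclideanSpace ℝ d)
    (hub : ∀ j, ∀ᵐ t ∂((volume : Measure ℝ).restrict (Ioo 0 T)), eSupNorm (u j t) < ⊤)
    (hu : ∀ j, MemLpBesovSup 1 (α : ℝ) 1 (u j) volume (Ioo 0 T))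
    (huK : ∀ j, eLpBesovSupNorm 1 (α : ℝ) 1 (u j) volume (Ioo 0 T) ≤ K j)
    (θ₀ : ℕ → UnitAddTorus d → ℝ) (hθ₀ : ∀ j, eBoundedHolderNorm β (θ₀ j) ≤ M)
    (θ : ℕ → ℝ → UnitAddTorus d → ℝ)
    (hθ : ∀ j, Torus.IsWeakScalarTransportOn T (κ j) (u j) (θ₀ j) (θ j))
    (henergy : ∀ j, ∀ᵐ t ∂((volume : Measure ℝ).restrict (Ioo 0 T)),
      (∫⁻ x, ‖θ j t x‖ₑ ^ 2) + 2 * Torus.eScalarDissipation (κ j) (θ j) 0 t ≤ ∫⁻ x, ‖θ₀ j x‖ₑ ^ 2)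
    (hbound : ∀ j, ∀ᵐ t ∂((volume : Measure ℝ).restrict (Ioo 0 T)),
      eBoundedHolderNorm β (θ j t) ≤ M) :
    Tendsto (fun j => Torus.eScalarDissipation (κ j) (θ j) 0 T) atTop (𝓝 0) := by
  obtain ⟨s, hs, hP, hQ⟩ := GrowingNorms.exists_scale_exponent hγ (by exact_mod_cast hβ.2) hOC
  refine GrowingNorms.tendsto_zero_of_scale_bound (K := fun j => (K j : ℝ))
    (a := (M : ℝ) ^ 2) (b := 2 * Fintype.card d * Torus.gradProfileMass d * (M : ℝ) ^ 2)
    (c := Fintype.card d * (Torus.gradProfileMass d ^ 2 * (M : ℝ) ^ 2)) (T := T)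
    hκ hκ₀ (fun j => NNReal.coe_nonneg _) hK
    (by have := Torus.gradProfileMass_nonneg (d := d); positivity) (by exact_mod_cast hβ.1)
    hs hP hQ fun j ε hε hε' => ?_
  refine (two_mul_eScalarDissipation_le_besov hT hα hβ.1 (hub j) (hu j) (huK j)
    (hθ₀ j) (hκ j) (hθ j) (henergy j) (hbound j) hε hε').trans (le_of_eq ?_)
  congr 1
  ring

end Literature.Barriers.AnomalousDissipation

end
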